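import Mathlib
import Summits.Ventures.HodgeRepro.Tier4.Common.HoloPositivity
import Summits.Ventures.HodgeRepro.Tier4.Common.HeckeRegularity

/-!
# Tier4/Common/ConcreteAssembly — `P_T4` from (P) for the concrete witness modulo (T2) Cartan–Serre and Osgood only

Blind re-derivation cell `pub-hodge-repro`, Tier 4 (README §9–§10), seat t4-typer-1 (gen 0).  Target tree path
`lean/Summits/Ventures/HodgeRepro/Tier4/Common/ConcreteAssembly.lean`.  Imports `HoloPositivity` ((T1) discharged)
and `HeckeRegularity` ((T3) discharged, (T0) reduced).

WHAT IS PROVED.  `residual_of`: the bundle `ConcreteResidual` from its two remaining textbook inputs — (T2) the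
finite-dimensionality of the holomorphic concrete forms of `X_{Γ′}` over `D` (Cartan–Serre) and the Osgood
regularity of the four corner fields — for a level `Γ′`, a measurable fundamental domain `D` with `closure D ⊆ 𝔹²`;
**`P_T4_of_concrete'`**: `P_T4` follows from (P) for the concrete witness of every datum under exactly these
inputs.  Nothing else is assumed anywhere in the chain from `Witness.P` to the frozen target.

Nothing here says anything about the status of the Hodge conjecture for CM abelian varieties, which is NOT proved
(HC_CM is NOT proved by anyone in this repository).
-/

set_option autoImplicit false

noncomputable section

open Matrix MeasureTheory NumberField Set
open scoped ComplexConjugate ComplexOrder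

namespace Summit.Ventures.HodgeRepro.Tier4

open Summit.Ventures.HodgeRepro.Tier4.Common

namespace TargetData

variable {F E : Type} [Field F] [NumberField F] [IsGalois ℚ F] [IsCMField F]
  [Field E] [NumberField E] [IsGalois ℚ E] [IsCMField E] (d : TargetData F E)

/-- **The residual bundle from its two open inputs**: (T2) finite-dimensionality and the Osgood regularity of the
corner fields, on a relatively compact measurable fundamental domain. -/
theorem residual_of {Γ' : Set (Matrix (Fin 3) (Fin 3) E)} (hΓ' : d.IsLevel Γ') {D : Set (Fin 2 → ℂ)}
    (hDom : d.IsDomain Γ' D) (hDc : closure D ⊆ ball) (hfin : FiniteDimensional ℂ (d.HForm Γ' D))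
    (hosgood : ∀ (i : Fin 4) (σ : F →+* ℂ) (hσ : σ ∈ d.T i), IsHolo1 (d.cornerField i σ hσ)) :
    d.ConcreteResidual Γ' D :=
  ⟨d.isPosDefOnHolo_holds hΓ' hDom, hfin, d.isCornerGoodOn_of hDc hDom.measurableSet hosgood,
    d.isHeckeGoodOn_of hΓ' hDc hDom.measurableSet⟩

/-- (P) for the concrete witness built from the two open inputs gives the conclusion of `P_T4`. -/
theorem conclusion_of_concrete_P' {Γ' : Set (Matrix (Fin 3) (Fin 3) E)} (hΓ' : d.IsLevel Γ') {D : Set (Fin 2 → ℂ)}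
    (hDom : d.IsDomain Γ' D) (hDc : closure D ⊆ ball) (hfin : FiniteDimensional ℂ (d.HForm Γ' D))
    (hosgood : ∀ (i : Fin 4) (σ : F →+* ℂ) (hσ : σ ∈ d.T i), IsHolo1 (d.cornerField i σ hσ))
    (hP : (d.concreteWitness hΓ' hDom.subset_ball hDom.measurableSet (d.residual_of hΓ' hDom hDc hfin hosgood)).P) :
    d.conclusion :=
  d.conclusion_of_concrete_P hΓ' hDom _ hP

end TargetData

/-- **`P_T4` modulo Cartan–Serre and Osgood**: if every datum has a level `Γ′`, a relatively compact measurable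
fundamental domain `D`, the finite-dimensionality of its holomorphic concrete forms, the Osgood regularity of its
corner fields, and (P) for the concrete witness, then `P_T4`. -/
theorem P_T4_of_concrete'
    (h : ∀ (F E : Type) [Field F] [NumberField F] [IsGalois ℚ F] [IsCMField F]
      [Field E] [NumberField E] [IsGalois ℚ E] [IsCMField E] (d : TargetData F E),
      ∃ (Γ' : Set (Matrix (Fin 3) (Fin 3) E)) (hΓ' : d.IsLevel Γ') (D : Set (Fin 2 → ℂ)) (hDom : d.IsDomain Γ' D)
        (hDc : closure D ⊆ ball) (hfin : FiniteDimensional ℂ (d.HForm Γ' D))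
        (hosgood : ∀ (i : Fin 4) (σ : F →+* ℂ) (hσ : σ ∈ d.T i), TargetData.IsHolo1 (d.cornerField i σ hσ)),
        (d.concreteWitness hΓ' hDom.subset_ball hDom.measurableSet (d.residual_of hΓ' hDom hDc hfin hosgood)).P) :
    P_T4 := by
  refine P_T4_of_forall fun F E _ _ _ _ _ _ _ _ d => ?_
  obtain ⟨Γ', hΓ', D, hDom, hDc, hfin, hosgood, hP⟩ := h F E d
  exact d.conclusion_of_concrete_P' hΓ' hDom hDc hfin hosgood hP

end Summit.Ventures.HodgeRepro.Tier4
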